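import Literature.NumberTheory.AdelicBaseChange.CompletionBaseChange
import Mathlib.NumberTheory.Padics.HeightOneSpectrum
import HarnessLib

/-!
# The semi-local algebra `ℚ_p ⊗_ℚ L ≅ ∏_{w ∣ p} L_w` of a number field, in the `ℚ_[p]` currency
# (Cassels–Fröhlich II §10 (10.2) at `K = ℚ`, transported along Mathlib's `ℚ_p ≅ ℚ_v`)

`Proofs` file (theorems only, no definitions, no named facts) in topic
`NumberTheory/AdelicBaseChange`.  The tree's vendored FLT packet (`CompletionBaseChange`) proves the
local base change `L ⊗[K] K_v ≃ₐ[L] ∏_{w ∣ v} L_w` for a finite extension of fraction fields of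
Dedekind domains (`IsDedekindDomain.HeightOneSpectrum.adicCompletion.baseChangeAlgEquiv`,
Cassels–Fröhlich, *Algebraic Number Theory*, Ch. II §10, Theorem, display (10.2)).  This file
specialises it to `K = ℚ` and re-expresses the completion `ℚ_v` of `ℚ` at the place `v = v_p` as
Mathlib's `ℚ_[p]` (`Padic.adicCompletionEquiv : ℚ_[p] ≃A[ℚ] v_p.adicCompletion ℚ`,
`v_p = primesEquiv.symm p`), the currency in which the elliptic-curve consumers are written
(`ℚ_[p] ⊗[ℚ] CyclotomicField m ℚ` in `Summit.…GaloisImage.KatoExpStarFiniteLevelAt`):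

* `exists_padicTensorAlgEquiv` — **there is a `ℚ`-algebra isomorphism
  `Ψ : ℚ_[p] ⊗[ℚ] L ≃ₐ[ℚ] ∏_{w ∣ v_p} L_w` with `Ψ(s ⊗ x)_w = x · e_p(s)`** (`e_p` Mathlib's
  `ℚ_[p] ≅ ℚ_{v_p}`, `x ↦ L_w` and `ℚ_{v_p} → L_w` the structure maps), for every number field `L`
  and prime `p`; every further statement is about ANY `ℚ`-algebra map with this formula on pure tensors
  (hypothesis `hΨ` spelled out), so a later named definition inherits them;
* `padicTensor_map_smul` — such a `Ψ` is `e_p`-SEMILINEAR for the `ℚ_[p]`-action: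
  `Ψ(s • t) = e_p(s) · Ψ(t)`;
* `padicTensor_tmul_mem_adicCompletionIntegers` — **integrality**: `Ψ(s ⊗ b)_w ∈ 𝒪_w` for
  `s ∈ ℤ_p`, `b ∈ 𝓞_L`; hence `padicTensor_mem_adicCompletionIntegers_of_mem_span`: `Ψ` maps the
  `ℤ_p`-span of the `1 ⊗ b`, `b ∈ 𝓞_L`, into `∏_w 𝒪_w` (for `L = ℚ(ζ_m)` this span contains the
  consumers' lattice `cycIntLattice p m = ℤ_p⟨1 ⊗ ζ^j⟩`).

Motivation (cell `bsd-addord`, crux `KatoKuriharaPortThreeShared`, residual ⟨C1⟩ clause (C1.c) =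
SAT₀; kim3 KIM3-W2-C1-SIZING-g12 §3 item (M) "semi-local étale algebra"): Kato's dual-exponential
value datum `Λ_{k,r}` is valued in `ℚ_p ⊗_ℚ ℚ(ζ_m)`; reading it prime by prime above `p` (where the
`exp*` of `Literature/NumberTheory/PAdicHodge/BlochKatoDualExponential` and the formal-group logarithm of
`FormalGroupChartLimitLog*` live) is exactly `Ψ`; the SAT₀ premise `Λ(y) − s ⊗ 1 ∈ p^{k+1}·L_int`
becomes `exp*_w(loc_w y) − e_p(s) ∈ p^{k+1}𝒪_w` by the integrality clause.  Only the EASY direction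
`Ψ(ℤ_p ⊗ 𝓞_L) ⊆ ∏ 𝒪_w` is proved (no ring-of-integers / different computation is needed by SAT₀).

## References

* [CasselsFrohlichANT1967] J. W. S. Cassels, A. Fröhlich (eds.), *Algebraic Number Theory* (1967),
  Ch. II (Cassels, *Global fields*) §10, Theorem and display (10.2).
* [FLTProject2025] the FLT project, `FLT/DedekindDomain/Completion/BaseChange.lean` (vendored in the
  tree as `Literature/NumberTheory/AdelicBaseChange/CompletionBaseChange.lean`).

## Design

No definitions: `Ψ` is produced existentially (the explicit composite
`congr e_p refl ≫ comm ≫ baseChangeAlgEquiv` appears only inside the proof), and the other theorems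
quantify over any `ℚ`-algebra hom with the pure-tensor formula.  `p : ℕ` with `[Fact p.Prime]`,
the place being `v_p = primesEquiv.symm ⟨p, _⟩`.  `noncomputable section`; axioms standard.
-/

noncomputable section

open scoped TensorProduct NumberField
open IsDedekindDomain NumberField

namespace Literature.NumberTheory.AdelicBaseChange

variable (L : Type) [Field L] [NumberField L] (p : ℕ) [Fact p.Prime]

/-- **The semi-local algebra of a number field at `p`, in the `ℚ_[p]` currency** (Cassels–Fröhlich
II §10 (10.2) at `K = ℚ`, composed with Mathlib's `ℚ_[p] ≅ ℚ_{v_p}`): there is a `ℚ`-algebra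
isomorphism `Ψ : ℚ_[p] ⊗[ℚ] L ≃ₐ[ℚ] ∏_{w ∣ v_p} L_w`, `v_p = primesEquiv.symm p`, given on pure tensors
by `Ψ(s ⊗ x)_w = (x : L_w) · (e_p s : L_w)` with `e_p = Padic.adicCompletionEquiv (𝓞 ℚ) ⟨p, Fact.out⟩`.
[cite: CasselsFrohlichANT1967, Ch. II §10 Theorem (10.2)] -/
theorem exists_padicTensorAlgEquiv :
    ∃ Ψ : ℚ_[p] ⊗[ℚ] L ≃ₐ[ℚ]
        (Π w : ((Rat.HeightOneSpectrum.primesEquiv (R := 𝓞 ℚ)).symm ⟨p, Fact.out⟩).Extension (𝓞 L),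
          w.1.adicCompletion L),
      ∀ (s : ℚ_[p]) (x : L)
        (w : ((Rat.HeightOneSpectrum.primesEquiv (R := 𝓞 ℚ)).symm ⟨p, Fact.out⟩).Extension (𝓞 L)),
        Ψ (s ⊗ₜ[ℚ] x) w = algebraMap L (w.1.adicCompletion L) x *
          algebraMap (((Rat.HeightOneSpectrum.primesEquiv (R := 𝓞 ℚ)).symm ⟨p, Fact.out⟩).adicCompletion ℚ)
            (w.1.adicCompletion L) (Padic.adicCompletionEquiv (𝓞 ℚ) ⟨p, Fact.out⟩ s) := by
  set v := (Rat.HeightOneSpectrum.primesEquiv (R := 𝓞 ℚ)).symm ⟨p, Fact.out⟩ with hv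
  let e : ℚ_[p] ≃ₐ[ℚ] v.adicCompletion ℚ := (Padic.adicCompletionEquiv (𝓞 ℚ) ⟨p, Fact.out⟩).toAlgEquiv
  let Ψ : ℚ_[p] ⊗[ℚ] L ≃ₐ[ℚ] (Π w : v.Extension (𝓞 L), w.1.adicCompletion L) :=
    (Algebra.TensorProduct.congr e (AlgEquiv.refl : L ≃ₐ[ℚ] L)).trans
      ((Algebra.TensorProduct.comm ℚ (v.adicCompletion ℚ) L).trans
        ((HeightOneSpectrum.adicCompletion.baseChangeAlgEquiv ℚ L (𝓞 L) v).restrictScalars ℚ))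
  refine ⟨Ψ, fun s x w ↦ ?_⟩
  change ((HeightOneSpectrum.adicCompletion.baseChangeAlgEquiv ℚ L (𝓞 L) v).restrictScalars ℚ)
    ((Algebra.TensorProduct.comm ℚ (v.adicCompletion ℚ) L)
      ((Algebra.TensorProduct.congr e (AlgEquiv.refl : L ≃ₐ[ℚ] L)) (s ⊗ₜ[ℚ] x))) w = _
  rw [Algebra.TensorProduct.congr_apply, Algebra.TensorProduct.map_tmul,
    Algebra.TensorProduct.comm_tmul, AlgEquiv.restrictScalars_apply]
  rfl

variable {L p}

/-- **`e_p`-semilinearity**: a `ℚ`-algebra map `Ψ : ℚ_[p] ⊗[ℚ] L → ∏_w L_w` with the pure-tensor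
formula satisfies `Ψ(s • t) = e_p(s) · Ψ(t)` for the `ℚ_[p]`-action on the left factor
(`s • t = (s ⊗ 1) · t`). [cite: CasselsFrohlichANT1967, Ch. II §10 Theorem (10.2)] -/
theorem padicTensor_map_smul
    (Ψ : ℚ_[p] ⊗[ℚ] L →ₐ[ℚ]
      (Π w : ((Rat.HeightOneSpectrum.primesEquiv (R := 𝓞 ℚ)).symm ⟨p, Fact.out⟩).Extension (𝓞 L),
        w.1.adicCompletion L))
    (hΨ : ∀ (s : ℚ_[p]) (x : L)
      (w : ((Rat.HeightOneSpectrum.primesEquiv (R := 𝓞 ℚ)).symm ⟨p, Fact.out⟩).Extension (𝓞 L)),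
      Ψ (s ⊗ₜ[ℚ] x) w = algebraMap L (w.1.adicCompletion L) x *
        algebraMap (((Rat.HeightOneSpectrum.primesEquiv (R := 𝓞 ℚ)).symm ⟨p, Fact.out⟩).adicCompletion ℚ)
          (w.1.adicCompletion L) (Padic.adicCompletionEquiv (𝓞 ℚ) ⟨p, Fact.out⟩ s))
    (s : ℚ_[p]) (t : ℚ_[p] ⊗[ℚ] L)
    (w : ((Rat.HeightOneSpectrum.primesEquiv (R := 𝓞 ℚ)).symm ⟨p, Fact.out⟩).Extension (𝓞 L)) :
    Ψ (s • t) w =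
      algebraMap (((Rat.HeightOneSpectrum.primesEquiv (R := 𝓞 ℚ)).symm ⟨p, Fact.out⟩).adicCompletion ℚ)
        (w.1.adicCompletion L) (Padic.adicCompletionEquiv (𝓞 ℚ) ⟨p, Fact.out⟩ s) * Ψ t w := by
  have hsmul : s • t = (s ⊗ₜ[ℚ] (1 : L)) * t := by
    rw [Algebra.smul_def]
    rfl
  rw [hsmul, map_mul, Pi.mul_apply, hΨ, map_one, one_mul]

/-- **Integrality on pure tensors**: `Ψ(s ⊗ b)_w ∈ 𝒪_w` for `s ∈ ℤ_p` and `b ∈ 𝓞_L` (a global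
integer is a local integer, `e_p(ℤ_p) = 𝒪_{v_p}` (Mathlib `PadicInt.adicCompletionIntegersEquiv`), and
the structure map `ℚ_{v_p} → L_w` carries `𝒪_{v_p}` into `𝒪_w`).
[cite: CasselsFrohlichANT1967, Ch. II §10 Theorem (10.2)] -/
theorem padicTensor_tmul_mem_adicCompletionIntegers
    (Ψ : ℚ_[p] ⊗[ℚ] L →ₐ[ℚ]
      (Π w : ((Rat.HeightOneSpectrum.primesEquiv (R := 𝓞 ℚ)).symm ⟨p, Fact.out⟩).Extension (𝓞 L),
        w.1.adicCompletion L))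
    (hΨ : ∀ (s : ℚ_[p]) (x : L)
      (w : ((Rat.HeightOneSpectrum.primesEquiv (R := 𝓞 ℚ)).symm ⟨p, Fact.out⟩).Extension (𝓞 L)),
      Ψ (s ⊗ₜ[ℚ] x) w = algebraMap L (w.1.adicCompletion L) x *
        algebraMap (((Rat.HeightOneSpectrum.primesEquiv (R := 𝓞 ℚ)).symm ⟨p, Fact.out⟩).adicCompletion ℚ)
          (w.1.adicCompletion L) (Padic.adicCompletionEquiv (𝓞 ℚ) ⟨p, Fact.out⟩ s))
    (s : ℤ_[p]) (b : 𝓞 L)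
    (w : ((Rat.HeightOneSpectrum.primesEquiv (R := 𝓞 ℚ)).symm ⟨p, Fact.out⟩).Extension (𝓞 L)) :
    Ψ ((s : ℚ_[p]) ⊗ₜ[ℚ] (b : L)) w ∈ w.1.adicCompletionIntegers L := by
  rw [hΨ]
  refine mul_mem ?_ ?_
  · exact HeightOneSpectrum.coe_mem_adicCompletionIntegers w.1 b
  · -- `e_p s ∈ 𝒪_v`, then `𝒪_v → 𝒪_w`
    have hs : Padic.adicCompletionEquiv (𝓞 ℚ) ⟨p, Fact.out⟩ (s : ℚ_[p]) ∈
        ((Rat.HeightOneSpectrum.primesEquiv (R := 𝓞 ℚ)).symm ⟨p, Fact.out⟩).adicCompletionIntegers ℚ := by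
      rw [← PadicInt.coe_adicCompletionIntegersEquiv_apply]
      exact (PadicInt.adicCompletionIntegersEquiv (𝓞 ℚ) ⟨p, Fact.out⟩ s).2
    exact w.adicCompletionSemialgHom_image_adicCompletionIntegers ℚ L ⟨_, hs, rfl⟩

/-- **Integrality of the image of `ℤ_p ⊗ 𝓞_L`**: a `ℚ`-algebra map `Ψ` with the pure-tensor formula
maps the `ℤ_p`-span of the elements `1 ⊗ b`, `b ∈ 𝓞_L`, into `∏_w 𝒪_w` (generators by the previous
theorem, `ℤ_p`-multiples by `e_p`-semilinearity).  For `L = ℚ(ζ_m)` this span contains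
`ℤ_p⟨1 ⊗ ζ_m^j⟩`, the lattice `L_int(m)` of the elliptic-curve consumers.
[cite: CasselsFrohlichANT1967, Ch. II §10 Theorem (10.2)] -/
theorem padicTensor_mem_adicCompletionIntegers_of_mem_span
    (Ψ : ℚ_[p] ⊗[ℚ] L →ₐ[ℚ]
      (Π w : ((Rat.HeightOneSpectrum.primesEquiv (R := 𝓞 ℚ)).symm ⟨p, Fact.out⟩).Extension (𝓞 L),
        w.1.adicCompletion L))
    (hΨ : ∀ (s : ℚ_[p]) (x : L)
      (w : ((Rat.HeightOneSpectrum.primesEquiv (R := 𝓞 ℚ)).symm ⟨p, Fact.out⟩).Extension (𝓞 L)),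
      Ψ (s ⊗ₜ[ℚ] x) w = algebraMap L (w.1.adicCompletion L) x *
        algebraMap (((Rat.HeightOneSpectrum.primesEquiv (R := 𝓞 ℚ)).symm ⟨p, Fact.out⟩).adicCompletion ℚ)
          (w.1.adicCompletion L) (Padic.adicCompletionEquiv (𝓞 ℚ) ⟨p, Fact.out⟩ s))
    {t : ℚ_[p] ⊗[ℚ] L}
    (ht : t ∈ Submodule.span ℤ_[p] (Set.range fun b : 𝓞 L ↦ (1 : ℚ_[p]) ⊗ₜ[ℚ] (b : L)))
    (w : ((Rat.HeightOneSpectrum.primesEquiv (R := 𝓞 ℚ)).symm ⟨p, Fact.out⟩).Extension (𝓞 L)) :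
    Ψ t w ∈ w.1.adicCompletionIntegers L := by
  induction ht using Submodule.span_induction with
  | mem x hx =>
    obtain ⟨b, rfl⟩ := hx
    have h := padicTensor_tmul_mem_adicCompletionIntegers Ψ hΨ 1 b w
    rwa [PadicInt.coe_one] at h
  | zero => rw [map_zero, Pi.zero_apply]; exact zero_mem _
  | add x y _ _ hx hy => rw [map_add, Pi.add_apply]; exact add_mem hx hy
  | smul s x _ hx =>
    have hs : Padic.adicCompletionEquiv (𝓞 ℚ) ⟨p, Fact.out⟩ (s : ℚ_[p]) ∈
        ((Rat.HeightOneSpectrum.primesEquiv (R := 𝓞 ℚ)).symm ⟨p, Fact.out⟩).adicCompletionIntegers ℚ := by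
      rw [← PadicInt.coe_adicCompletionIntegersEquiv_apply]
      exact (PadicInt.adicCompletionIntegersEquiv (𝓞 ℚ) ⟨p, Fact.out⟩ s).2
    have hsmul : (s • x : ℚ_[p] ⊗[ℚ] L) = (s : ℚ_[p]) • x := rfl
    rw [hsmul, padicTensor_map_smul Ψ hΨ]
    exact mul_mem (w.adicCompletionSemialgHom_image_adicCompletionIntegers ℚ L ⟨_, hs, rfl⟩) hx

end Literature.NumberTheory.AdelicBaseChange

end
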